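import Literature.MeasureTheory.RestrictedProduct.ProductMeasure

/-!
# Restricted product measures, III: the product formula on the cylinders `A_S`, uniqueness, σ-finiteness

Topic `MeasureTheory/RestrictedProduct`; concludes `LevelMeasure` / `ProductMeasure`. With
`μ = rpMeasure K ν S₀` the restricted product measure on `Πʳ i, [G i, K i]` and, for a finite `S ⊇ S₀`,
the coordinates `e_S : (Π_{i∈S} G_i) × (Π_{i∉S} K_i) → A_S` (`glue`, a measurable embedding onto the cylinder
`A_S = rpBox K S`) and the mass-one measure `ρ_S = ⨂_{i∉S} κ_i` on `Π_{i∉S} K_i` (`rho`, `kap`):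

* `rpMeasure_restrict_rpBox` — **Tate's thesis, Cassels–Fröhlich (1967) Ch. XV §3.3 / Leahy (2010) Prop. 3.1.8,
  existence half, as a theorem**: `μ|_{A_S} = (e_S)_* ((∏_{i∈S} ν_i) ⊗ ρ_S)` for every finite `S ⊇ S₀` ("the
  restriction of `dα` to `G_S` is precisely the product measure");
* `map_incl_rpMeasure_restrict` — level-free form: `μ|_{A_S}` pushed to `Π i, G i` is `λ_S`;
* `ext_of_restrict_rpBox`, `eq_rpMeasure` — **uniqueness**: a measure on the restricted product is determined by its
  restrictions to the `A_S`, `S ⊇ S₀`, and `rpMeasure` is the only one with the product restrictions;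
* `sigmaFinite_rpMeasure` — `μ` is σ-finite.

Everything is proved (Mathlib only). Not here: invariance / Haar-ness of `μ` when the `G i` are groups and the
`K i` compact open subgroups, and the identification of the trace σ-algebra with the Borel σ-algebra (separate
files of the same lineage).

## Provenance

Reproduced for the tree under the LEAN-IN-TREE rule (2026-08-18) from the pub-hodgecm cell's package file
`HodgeCM/PerL34/RestrictedMeasure.lean` (seat pv09-g2, gate run 22), part 3 of 3, verbatim up to the namespace
(`HodgeCM.PerL34.RestrictedMeasure` ↦ `Literature.MeasureTheory.RestrictedProduct`) and the added docstrings.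
-/

set_option autoImplicit false

noncomputable section

open _root_.MeasureTheory Filter Set Function
open scoped Classical ENNReal
open scoped RestrictedProduct

namespace Literature.MeasureTheory.RestrictedProduct

universe u v

variable {ι : Type u} {G : ι → Type v} [∀ i, MeasurableSpace (G i)]
variable (K : ∀ i, Set (G i)) (ν : ∀ i, Measure (G i))

section restricted

/-! #### The compact factor `C S = Π_{i∉S} K_i`, its mass-one measure, and the gluing map `e S` -/

variable (hKne : ∀ i, (K i).Nonempty)

/-- A probability measure on the subtype `K_i`: `ν_i|K_i` when `ν_i(K_i) = 1` (the case `i ∉ S₀`),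
else (irrelevant levels) a Dirac mass. [folklore] -/
def kap (i : ι) : Measure (K i) :=
  if ν i (K i) = 1 then Measure.comap Subtype.val (ν i)
  else Measure.dirac ⟨(hKne i).some, (hKne i).some_mem⟩

/-- `κ_i` is a probability measure. [folklore] -/
theorem isProbabilityMeasure_kap (hKm : ∀ i, MeasurableSet (K i)) (i : ι) :
    IsProbabilityMeasure (kap K ν hKne i) := by
  unfold kap
  split_ifs with h
  · refine ⟨?_⟩
    rw [(MeasurableEmbedding.subtype_coe (hKm i)).comap_apply, image_univ, Subtype.range_coe, h]
  · infer_instance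

/-- For `ν_i(K_i) = 1`, `κ_i` pushed to `G_i` is `ν_i|_{K_i}`. [folklore] -/
theorem map_val_kap {i : ι} (hKm : MeasurableSet (K i)) (h1 : ν i (K i) = 1) :
    (kap K ν hKne i).map Subtype.val = locK K ν i := by
  rw [kap, if_pos h1, (MeasurableEmbedding.subtype_coe hKm).map_comap, Subtype.range_coe]
  rfl

/-- The mass-one measure `ρ_S = ⨂_{i∉S} κ_i` on the compact factor `C S = Π_{i∉S} K_i`. [folklore] -/
def rho (S : Finset ι) : Measure ((i : {i // i ∉ S}) → K i) :=
  Measure.infinitePi fun i : {i // i ∉ S} => kap K ν hKne i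

/-- `ρ_S` is a probability measure. [folklore] -/
theorem isProbabilityMeasure_rho (hKm : ∀ i, MeasurableSet (K i)) (S : Finset ι) :
    IsProbabilityMeasure (rho K ν hKne S) := by
  haveI : ∀ i : {i // i ∉ S}, IsProbabilityMeasure (kap K ν hKne i) :=
    fun i => isProbabilityMeasure_kap K ν hKne hKm i
  unfold rho; infer_instance

/-- The gluing map `e_S : (Π_{i∈S} G_i) × (Π_{i∉S} K_i) → Πʳ i, [G i, K i]`. [folklore] -/
def glue (S : Finset ι) (p : ((i : {i // i ∈ S}) → G i) × ((i : {i // i ∉ S}) → K i)) :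
    Πʳ i, [G i, K i] :=
  RestrictedProduct.mk ((split S).symm (p.1, fun i => (p.2 i : G i)))
    (Filter.eventually_cofinite.2 (S.finite_toSet.subset fun i hi => by
      by_contra h
      exact hi (by rw [split_symm_apply_of_not_mem (G := G) S _ h]; exact (p.2 ⟨i, h⟩).2)))

omit [∀ i, MeasurableSpace (G i)] in
/-- The gluing map followed by the inclusion is the regrouping. [folklore] -/
theorem incl_glue (S : Finset ι) (p : ((i : {i // i ∈ S}) → G i) × ((i : {i // i ∉ S}) → K i)) :
    incl K (glue K S p) = (split S).symm (p.1, fun i => (p.2 i : G i)) := rfl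

omit [∀ i, MeasurableSpace (G i)] in
/-- Functional form of `incl_glue`. [folklore] -/
theorem incl_comp_glue (S : Finset ι) :
    incl K ∘ glue K S = (split S).symm ∘ Prod.map id (fun z i => ((z i : K (i : ι)) : G i)) := rfl

/-- `K_i`-valued truncation of a point of `G_i` (the default value is never used on `A_S`). [folklore] -/
def projK (i : ι) (g : G i) : K i :=
  if h : g ∈ K i then ⟨g, h⟩ else ⟨(hKne i).some, (hKne i).some_mem⟩

/-- The truncation `G_i → K_i` is measurable. [folklore] -/
theorem measurable_projK {i : ι} (hKm : MeasurableSet (K i)) : Measurable (projK K hKne i) := by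
  refine (MeasurableEmbedding.subtype_coe hKm).measurable_comp_iff.1 ?_
  have : (Subtype.val ∘ projK K hKne i) = fun g => if g ∈ K i then g else (hKne i).some := by
    funext g; simp only [comp_apply, projK]; split_ifs <;> rfl
  rw [this]
  exact Measurable.ite hKm measurable_id measurable_const

/-- The inverse of the gluing map on `A_S`. [folklore] -/
def unglue (S : Finset ι) (x : Πʳ i, [G i, K i]) :
    ((i : {i // i ∈ S}) → G i) × ((i : {i // i ∉ S}) → K i) :=
  (fun i => x i, fun i => projK K hKne i (x i))

omit [∀ i, MeasurableSpace (G i)] in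
/-- `unglue S` is a left inverse of the gluing map `e_S`. [folklore] -/
theorem unglue_glue (S : Finset ι) : LeftInverse (unglue K hKne S) (glue K S) := by
  rintro ⟨y, z⟩
  refine Prod.ext (funext fun i => ?_) (funext fun i => ?_)
  · show (split S).symm (y, fun i => (z i : G i)) i = y i
    rw [split_symm_apply_of_mem (G := G) S _ i.2]
  · show projK K hKne i ((split S).symm (y, fun i => (z i : G i)) i) = z i
    rw [split_symm_apply_of_not_mem (G := G) S _ i.2, projK, dif_pos (z i).2]

omit [∀ i, MeasurableSpace (G i)] in
include hKne in
/-- The gluing map `e_S` has range exactly the cylinder `A_S`. [folklore] -/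
theorem range_glue (S : Finset ι) : range (glue K S) = rpBox K S := by
  refine subset_antisymm ?_ fun x hx => ⟨unglue K hKne S x, ?_⟩
  · rintro _ ⟨p, rfl⟩ i hi
    show (split S).symm (p.1, fun i => (p.2 i : G i)) i ∈ K i
    rw [split_symm_apply_of_not_mem (G := G) S _ hi]
    exact (p.2 ⟨i, hi⟩).2
  · refine RestrictedProduct.ext _ _ fun i => ?_
    show (split S).symm ((unglue K hKne S x).1, fun i => ((unglue K hKne S x).2 i : G i)) i = x i
    by_cases hi : i ∈ S
    · rw [split_symm_apply_of_mem (G := G) S _ hi]; rfl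
    · rw [split_symm_apply_of_not_mem (G := G) S _ hi]
      show (projK K hKne i (x i) : G i) = x i
      rw [projK, dif_pos (hx i hi)]

variable [Countable ι]

/-- The inclusion into `Π i, G i` is measurable. [folklore] -/
theorem measurable_incl (hKm : ∀ i, MeasurableSet (K i)) : Measurable (incl K) :=
  (measurableEmbedding_incl K hKm).measurable

omit [Countable ι] in
/-- The coordinatewise inclusion `Π_{i∉S} K_i → Π_{i∉S} G_i` is measurable. [folklore] -/
theorem measurable_valPi (S : Finset ι) :
    Measurable (fun (z : (i : {i // i ∉ S}) → K i) (i : {i // i ∉ S}) => ((z i : K (i : ι)) : G i)) :=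
  measurable_pi_lambda _ fun i => measurable_subtype_coe.comp (measurable_pi_apply i)

/-- The gluing map `e_S` is measurable. [folklore] -/
theorem measurable_glue (hKm : ∀ i, MeasurableSet (K i)) (S : Finset ι) : Measurable (glue K S) := by
  refine (measurableEmbedding_incl K hKm).measurable_comp_iff.1 ?_
  rw [incl_comp_glue]
  exact (measurable_split_symm S).comp (measurable_id.prodMap (measurable_valPi K S))

/-- `unglue S` is measurable. [folklore] -/
theorem measurable_unglue (hKm : ∀ i, MeasurableSet (K i)) (S : Finset ι) :
    Measurable (unglue K hKne S) := by
  refine Measurable.prodMk (measurable_pi_lambda _ fun i => ?_) (measurable_pi_lambda _ fun i => ?_)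
  · exact (measurable_pi_apply (i : ι)).comp (measurable_incl K hKm)
  · exact (measurable_projK K hKne (hKm i)).comp ((measurable_pi_apply (i : ι)).comp (measurable_incl K hKm))

include hKne in
/-- The gluing map `e_S` is a measurable embedding (onto `A_S`). [folklore] -/
theorem measurableEmbedding_glue (hKm : ∀ i, MeasurableSet (K i)) (S : Finset ι) :
    MeasurableEmbedding (glue K S) :=
  MeasurableEmbedding.of_measurable_inverse (measurable_glue K hKm S)
    (by rw [range_glue K hKne]; exact measurableSet_rpBox K hKm S)
    (measurable_unglue K hKne hKm S) (unglue_glue K hKne S)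

variable [∀ i, SigmaFinite (ν i)]

/-- **The restricted product measure on `A_S` is the product measure** (Tate, Thm 3.3.1; Leahy,
Prop 3.1.8 — existence half, as a theorem): for `S ⊇ S₀`,
`μ|_{A_S} = (e_S)_* ((∏_{i∈S} ν_i) ⊗ ρ_S)`. [cite: CasselsFrohlichANT1967, Ch. XV (Tate) §3.3, PDF pp. 352–353] -/
theorem rpMeasure_restrict_rpBox (hKm : ∀ i, MeasurableSet (K i)) {S₀ : Finset ι}
    (hK1 : ∀ i, i ∉ S₀ → ν i (K i) = 1) {S : Finset ι} (hS : S₀ ⊆ S) :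
    (rpMeasure K ν S₀).restrict (rpBox K S) =
      Measure.map (glue K S) ((Measure.pi fun i : {i // i ∈ S} => ν i).prod (rho K ν hKne S)) := by
  have hemb := measurableEmbedding_incl K hKm
  haveI : ∀ i : {i // i ∉ S}, IsProbabilityMeasure (kap K ν hKne i) :=
    fun i => isProbabilityMeasure_kap K ν hKne hKm i
  haveI := isProbabilityMeasure_rho K ν hKne hKm S
  rw [← hemb.comap_map ((rpMeasure K ν S₀).restrict (rpBox K S)),
    ← hemb.comap_map (Measure.map (glue K S) _)]
  congr 1
  rw [rpBox_eq, rpMeasure, ← hemb.restrict_map, hemb.map_comap,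
    Measure.restrict_restrict (measurableSet_box K hKm S),
    Set.inter_eq_left.2 (box_subset_range_incl K S), glued_restrict_box K ν S₀ hKm hK1 hS,
    Measure.map_map hemb.measurable (measurable_glue K hKm S), incl_comp_glue,
    ← Measure.map_map (measurable_split_symm S) (measurable_id.prodMap (measurable_valPi K S)),
    ← Measure.map_prod_map _ _ measurable_id (measurable_valPi K S), Measure.map_id, rho,
    Measure.infinitePi_map_pi (fun i : {i // i ∉ S} => kap K ν hKne i) (f := fun i => Subtype.val)
      (fun i => measurable_subtype_coe)]
  have hfam : (fun i : {i // i ∉ S} => (kap K ν hKne i).map Subtype.val) =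
      fun i : {i // i ∉ S} => locK K ν i :=
    funext fun i => map_val_kap K ν hKne (hKm i) (hK1 i fun h' => i.2 (hS h'))
  rw [hfam]
  rfl

/-- The level-free form: `μ|_{A_S}` pushed to `Π i, G i` is the level-`S` measure `λ_S`. [folklore] -/
theorem map_incl_rpMeasure_restrict (hKm : ∀ i, MeasurableSet (K i)) {S₀ : Finset ι}
    (hK1 : ∀ i, i ∉ S₀ → ν i (K i) = 1) {S : Finset ι} (hS : S₀ ⊆ S) :
    ((rpMeasure K ν S₀).restrict (rpBox K S)).map (incl K) = level K ν S := by
  have hemb := measurableEmbedding_incl K hKm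
  rw [rpBox_eq, rpMeasure, ← hemb.restrict_map, hemb.map_comap,
    Measure.restrict_restrict (measurableSet_box K hKm S),
    Set.inter_eq_left.2 (box_subset_range_incl K S), glued_restrict_box K ν S₀ hKm hK1 hS]

/-! #### Uniqueness and σ-finiteness -/

omit [∀ i, MeasurableSpace (G i)] [Countable ι] [∀ i, SigmaFinite (ν i)] in
/-- The cylinders `A_{S₀ ∪ S}` exhaust the restricted product. [folklore] -/
theorem iUnion_rpBox_union (S₀ : Finset ι) : (⋃ S : Finset ι, rpBox K (S₀ ∪ S)) = univ :=
  eq_univ_of_forall fun x => by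
    obtain ⟨S, hS⟩ := exists_mem_rpBox K x
    exact mem_iUnion.2 ⟨S, rpBox_mono K Finset.subset_union_right hS⟩

omit [∀ i, SigmaFinite (ν i)] in
/-- **Uniqueness**: a measure on the restricted product is determined by its restrictions to the
cylinders `A_S`, `S ⊇ S₀`. [cite: CasselsFrohlichANT1967, Ch. XV (Tate) §3.3, PDF pp. 352–353] -/
theorem ext_of_restrict_rpBox (S₀ : Finset ι) {μ₁ μ₂ : Measure (Πʳ i, [G i, K i])}
    (h : ∀ S : Finset ι, S₀ ⊆ S → μ₁.restrict (rpBox K S) = μ₂.restrict (rpBox K S)) : μ₁ = μ₂ :=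
  (Measure.ext_iff_of_iUnion_eq_univ (iUnion_rpBox_union K S₀)).2
    fun _ => h _ Finset.subset_union_left

/-- `rpMeasure K ν S₀` is the UNIQUE measure on `Πʳ i, [G i, K i]` whose restriction to every `A_S`,
`S ⊇ S₀`, is the product measure (the uniqueness clause of Leahy Prop. 3.1.8). [cite: CasselsFrohlichANT1967, Ch. XV (Tate) §3.3, PDF pp. 352–353] -/
theorem eq_rpMeasure (hKm : ∀ i, MeasurableSet (K i)) {S₀ : Finset ι}
    (hK1 : ∀ i, i ∉ S₀ → ν i (K i) = 1) (μ' : Measure (Πʳ i, [G i, K i]))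
    (h : ∀ S : Finset ι, S₀ ⊆ S → μ'.restrict (rpBox K S) =
      Measure.map (glue K S) ((Measure.pi fun i : {i // i ∈ S} => ν i).prod (rho K ν hKne S))) :
    μ' = rpMeasure K ν S₀ :=
  ext_of_restrict_rpBox K S₀ fun S hS => by
    rw [h S hS, rpMeasure_restrict_rpBox K ν hKne hKm hK1 hS]

/-- The restricted product measure is σ-finite. [folklore] -/
theorem sigmaFinite_rpMeasure (hKm : ∀ i, MeasurableSet (K i)) {S₀ : Finset ι}
    (hK1 : ∀ i, i ∉ S₀ → ν i (K i) = 1) : SigmaFinite (rpMeasure K ν S₀) := by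
  refine Measure.sigmaFinite_of_countable
    (S := Set.range fun p : Finset ι × ℕ =>
      incl K ⁻¹' spanningBox ν (S₀ ∪ p.1) p.2 ∩ rpBox K (S₀ ∪ p.1))
    (Set.countable_range _) ?_ ?_
  · rintro _ ⟨⟨S, n⟩, rfl⟩
    dsimp only
    rw [← Measure.restrict_apply' (measurableSet_rpBox K hKm _),
      ← Measure.map_apply (measurable_incl K hKm) (measurableSet_spanningBox ν _ n),
      map_incl_rpMeasure_restrict K ν hKm hK1 Finset.subset_union_left]
    exact (level_spanningBox_ne_top K ν _ (fun i hi => isProbabilityMeasure_locK K ν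
      (hK1 i fun h' => hi (Finset.mem_union_left _ h'))) n).lt_top
  · rw [Set.sUnion_range]
    refine eq_univ_of_forall fun x => ?_
    obtain ⟨S, hS⟩ := exists_mem_rpBox K x
    exact mem_iUnion.2 ⟨(S, (S₀ ∪ S).sup fun i => spanningSetsIndex (ν i) (x i)),
      mem_spanningBox_sup ν (S₀ ∪ S) (incl K x), rpBox_mono K Finset.subset_union_right hS⟩

end restricted

end Literature.MeasureTheory.RestrictedProduct

end
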